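import Mathlib.RingTheory.RegularLocalRing.Polynomial
import Literature.AlgebraicGeometry.Resolution.AbhyankarValuationsLocalUniformization
import Literature.AlgebraicGeometry.CossartPiltant200819.Threefolds2008
import HarnessLib

/-!
# Cossart–Piltant 2008, Theorem 7.2: the proof as a tower of typed moves

Cossart, Piltant, *Resolution of singularities of threefolds in positive characteristic I*,
J. Algebra 320 (2008) 1051–1082 (numbering of the HAL preprint hal-00139124, as in
`Ramification2008.lean`). Theorem 7.2 (HAL pp. 19–21) reduces local uniformization of rank-one
valuations with algebraic residue field extension, in transcendence degree three, to the
immediate Artin–Schreier / purely inseparable degree-`p` case (`ArtinSchreierHypothesis`). In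
`Ramification2008.lean` it is the NAMED FACT `ReductionToArtinSchreier`. Here its PROOF
(HAL pp. 20–21, "Abhyankar's strategy") is formalised as far as it is bookkeeping:

* `VState k` — a function field over `k` with a `k`-valuation ring (a stage `(F, W ∩ F)` of the
  proof); `VState.HasLU` — "has a local uniformization" (`Resolution.IsLocallyUniformizable`).
* `Move3 k s t` — ONE step of the proof, an inductive Prop whose four constructors carry EXACTLY
  the non-inductive hypotheses of the four results the proof invokes: Cor 6.3 (climb to the
  inertia field, `ClimbToInertiaField`), Prop 8.3 (non-immediate prime degree ascent,
  `PrimeDegreeAscent`), the hypothesis of Thm 7.2 (immediate degree-`p` step; the local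
  uniformization `R` of the lower stage is only known at run time, so the constructor asks for an
  adapted generator `h = X^p − g^{p−1}X + f`, `f, g ∈ m_R`, for EVERY local uniformization `R`:
  `AdmitsASGenerator`), and Prop 9.5 (descent below the ramification field,
  `DescentBelowRamificationField`); plus a bookkeeping move `iso` (renaming a stage along a
  `k`-isomorphism of valued fields, implicit in print). PROVED: `Move3.hasLU` — along a move,
  local uniformization propagates, given those four statements (the `iso` move by the tree's
  transport lemma `Resolution.isLocallyUniformizable_comap_of_model`).
* `isLocallyUniformizable_of_algebraicIndependent_of_adjoin_eq_top` — PROVED: the base case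
  "`V₀ := V ∩ k(x₁,x₂,x₃)` has a local uniformization on the regular projective model `ℙ³_k`"
  (HAL p. 20): every `k`-valuation ring of a purely transcendental `k(x)` is uniformized by the
  polynomial chart `k[y] ⊆ V₀`, `yᵢ ∈ {xᵢ, xᵢ⁻¹}` (any number of variables, any `k`).
* `TowerExists2008 k` — NAMED FACT, the field- and valuation-theoretic content of HAL
  pp. 20–21: from a purely transcendental stage one reaches `(K, V)` by finitely many moves
  (separating transcendence basis and the purely inseparable degree-`p` tower `K₁ ⊂ … ⊂ K`,
  absent for `k` perfect by Matsumura Thm 26.3; Galois closure `L/K₀`; `K₀ ⊆ K₀ⁱ` by Cor 6.3;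
  `K₀ⁱ ⊆ K₀ʳ` a tower of abelian prime-to-`p` steps, totally ramified by eqs. (8)–(9);
  `K₀ʳ ⊆ Kʳ` a tower of Galois degree-`p` steps from a central series of the `p`-group `G⁰_r`,
  eq. (32); each degree-`p` step immediate or with `e = p` or `f = p`; the Artin–Schreier /
  `p`-th root generator rescaled into `m_R`; `K ⊆ Kʳ` and Prop 9.5). This is the one leaf of the
  proof that is not one of the paper's numbered statements.
* PROVED: `Reach3.hasLU`, `lu3RankOne_of_tower` and
  `reductionToArtinSchreier_of_tower : ClimbToInertiaField → PrimeDegreeAscent →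
  DescentBelowRamificationField → (∀ k, TowerExists2008 k) → ReductionToArtinSchreier`, and the
  top-level `lu3DiffFinite_of_tower` (with Prop 5.1 and [CP2] via `Threefolds2008.lu3_of_leaves`).

Where dimension three enters: only through the hypotheses "`trdeg_k = 3`" handed to the four
leaves (Cor 6.3, Prop 8.3, Thm 7.2's hypothesis, Prop 9.5); the tower itself and the base case
are dimension free (the base case is proved for every number of variables).

Design: stages are bundled (`VState k : Type (u+1)`, fields `K : Type u` in the universe of `k`,
as in all `CP2008` statements), so a path of moves may change the field; equalities of stages
needed to splice moves (`(W ∩ F') ∩ F = W ∩ F`) are propositional and are the burden of whoever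
discharges `TowerExists2008`. Deliberately NOT here: the abstract node skeleton
(`Skeleton2008.lean`, whose signature sorts live in `Type` and cannot be instantiated by bundled
fields over `k : Type u`); Lemma 9.4 and Prop 9.3 (used inside the proof of Prop 9.5, a leaf).
-/

namespace Literature.AlgebraicGeometry.CossartPiltant200819.CP2008

open Literature.AlgebraicGeometry.Resolution Polynomial

universe u

/-! ### The base case: purely transcendental fields (HAL p. 20, "`R₀` on `ℙ³_k`") -/

section PurelyTranscendental

variable {k K : Type u} [Field k] [Field K] [Algebra k K]

/-- Every element of the subfield `k(s)` is algebraic over the subalgebra `k[s]` (it is a quotient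
of two of its elements). (Same statement as `…Theorems.Lupi.isAlgebraic_adjoin_of_mem_adjoin` on
the Summits side, which a Literature file cannot import.) [folklore] -/
theorem isAlgebraic_algebraAdjoin_of_mem_adjoin {s : Set K} {a : K}
    (ha : a ∈ IntermediateField.adjoin k s) : IsAlgebraic (Algebra.adjoin k s) a := by
  obtain ⟨r, hr, q, hq, rfl⟩ := IntermediateField.mem_adjoin_iff_div.mp ha
  rw [div_eq_mul_inv]
  exact (isAlgebraic_algebraMap (⟨r, hr⟩ : Algebra.adjoin k s)).mul
    (IsAlgebraic.inv_iff.mpr (isAlgebraic_algebraMap (⟨q, hq⟩ : Algebra.adjoin k s)))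

/-- The **`O`-adapted inversion** of a family `x`: `yᵢ := xᵢ` if `xᵢ ∈ O`, else `xᵢ⁻¹`; so
`yᵢ ∈ O` ("with `V xᵢ ≥ 0`", HAL p. 20, after inverting). (Same statement as
`…Theorems.Lupi.exists_eq_or_eq_inv_mem` on the Summits side, not importable here.) [folklore] -/
theorem exists_eq_or_eq_inv_mem_valuationSubring (O : ValuationSubring K) {n : ℕ}
    (x : Fin n → K) : ∃ y : Fin n → K, (∀ i, y i ∈ O) ∧ ∀ i, y i = x i ∨ y i = (x i)⁻¹ := by
  classical
  refine ⟨fun i => if x i ∈ O then x i else (x i)⁻¹, fun i => ?_, fun i => ?_⟩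
  · by_cases h : x i ∈ O
    · simp only [h, if_true]
    · simp only [h, if_false]
      exact (O.mem_or_inv_mem (x i)).resolve_left h
  · by_cases h : x i ∈ O
    · exact Or.inl (by simp only [h, if_true])
    · exact Or.inr (by simp only [h, if_false])

/-- If `x` is algebraically independent and generates `K = k(x)`, every family `y` with
`yᵢ ∈ {xᵢ, xᵢ⁻¹}` is again algebraically independent (`K` is algebraic over `k[y]`, and `y` has
`trdeg_k K` members). [folklore] -/
theorem algebraicIndependent_of_eq_or_eq_inv_of_adjoin_eq_top {n : ℕ} {x y : Fin n → K}
    (hx : AlgebraicIndependent k x) (htop : IntermediateField.adjoin k (Set.range x) = ⊤)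
    (hy : ∀ i, y i = x i ∨ y i = (x i)⁻¹) : AlgebraicIndependent k y := by
  haveI : FaithfulSMul k K :=
    (faithfulSMul_iff_algebraMap_injective k K).mpr (algebraMap k K).injective
  have hyi : ∀ i, IsAlgebraic (Algebra.adjoin k (Set.range y)) (x i) := by
    intro i
    have h0 : IsAlgebraic (Algebra.adjoin k (Set.range y)) (y i) :=
      isAlgebraic_algebraMap (⟨y i, Algebra.subset_adjoin ⟨i, rfl⟩⟩ : Algebra.adjoin k (Set.range y))
    rcases hy i with h | h
    · rwa [h] at h0
    · rw [← inv_inv (x i), ← h]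
      exact IsAlgebraic.inv_iff.mpr h0
  haveI : Algebra.IsAlgebraic (Algebra.adjoin k (Set.range y)) K := by
    refine ⟨fun a => ?_⟩
    have ha : IsAlgebraic (Algebra.adjoin k (Set.range x)) a :=
      isAlgebraic_algebraAdjoin_of_mem_adjoin (by rw [htop]; exact IntermediateField.mem_top)
    exact ha.adjoin_of_forall_isAlgebraic fun z hz => by
      obtain ⟨i, rfl⟩ := hz.1
      exact hyi i
  exact (Algebra.IsAlgebraic.isTranscendenceBasis_of_lift_le_trdeg_of_finite k y
    hx.lift_cardinalMk_le_trdeg).1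

/-- **The base case of the proof of Thm 7.2** (HAL p. 20: "`V₀ := V ∩ K₀` has a local
uniformization `R₀` on the regular projective model `ℙ³_k` of `K₀`"), PROVED for any number of
variables and any ground field: if `K = k(x)` with `x` algebraically independent, every
`k`-valuation ring `O` of `K` is locally uniformizable — the affine chart `k[y] ⊆ O`,
`yᵢ ∈ {xᵢ, xᵢ⁻¹}`, of `ℙⁿ_k` containing the centre is a polynomial ring, regular at every prime
(Mathlib `MvPolynomial.isRegularRing_of_isRegularRing`), with fraction field `K`.
[cite: CossartPiltant2008, Thm 7.2 proof (HAL p. 20, base case)] -/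
theorem isLocallyUniformizable_of_algebraicIndependent_of_adjoin_eq_top {n : ℕ} (x : Fin n → K)
    (hx : AlgebraicIndependent k x) (htop : IntermediateField.adjoin k (Set.range x) = ⊤)
    (O : ValuationSubring K) (hO : ∀ c : k, algebraMap k K c ∈ O) :
    IsLocallyUniformizable k K O := by
  classical
  obtain ⟨y, hyO, hy⟩ := exists_eq_or_eq_inv_mem_valuationSubring O x
  have hyind : AlgebraicIndependent k y :=
    algebraicIndependent_of_eq_or_eq_inv_of_adjoin_eq_top hx htop hy
  set A : Subalgebra k K := Algebra.adjoin k (Set.range y) with hA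
  have h₀ : A.toSubring ≤ O.toSubring := by
    let Oalg : Subalgebra k K := { O.toSubring with algebraMap_mem' := hO }
    change A ≤ Oalg
    exact Algebra.adjoin_le (by rintro _ ⟨i, rfl⟩; exact hyO i)
  haveI : IsRegularRing A := IsRegularRing.of_ringEquiv hyind.aevalEquiv.toRingEquiv
  have hfg : A.FG := by
    refine ⟨Finset.univ.image y, ?_⟩
    rw [Finset.coe_image, Finset.coe_univ, Set.image_univ]
  have hyF : ∀ i, y i ∈ IntermediateField.adjoin k (A : Set K) := fun i =>
    IntermediateField.subset_adjoin k _ (Algebra.subset_adjoin ⟨i, rfl⟩)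
  have hxF : IntermediateField.adjoin k (Set.range x) ≤ IntermediateField.adjoin k (A : Set K) := by
    rw [IntermediateField.adjoin_le_iff]
    rintro _ ⟨i, rfl⟩
    rcases hy i with h | h
    · exact h ▸ hyF i
    · have : x i = (y i)⁻¹ := by rw [h, inv_inv]
      rw [this]
      exact inv_mem (hyF i)
  have hfrac : IsFractionRing A K := by
    refine IsFractionRing.of_field A K fun z => ?_
    have hz : z ∈ IntermediateField.adjoin k (A : Set K) :=
      hxF (by rw [htop]; exact IntermediateField.mem_top)
    obtain ⟨a, ha, b, hb, rfl⟩ := IntermediateField.mem_adjoin_iff_div.mp hz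
    rw [Algebra.adjoin_eq] at ha hb
    exact ⟨⟨a, ha⟩, ⟨b, hb⟩, rfl⟩
  refine ⟨A, h₀, hfg, hfrac, ?_⟩
  change IsRegularLocalRing (Localization.AtPrime (centreIdeal A O h₀))
  infer_instance

end PurelyTranscendental

/-! ### Stages and moves of the proof (HAL pp. 20–21) -/

/-- A **stage** of the proof of Thm 7.2: a field `F` over `k` (in the proof: one of `K₀`,
`K₀ⁱ`, `K₀ʳ`, the fields of the towers, `Kʳ`, `K₁,ᵢ`, `K`) together with a `k`-valuation ring of
`F` (in the proof: the trace `W ∩ F` of one valuation ring `W` of the Galois closure).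
[cite: CossartPiltant2008, Thm 7.2 proof (HAL pp. 20–21)] -/
structure VState (k : Type u) [Field k] : Type (u + 1) where
  /-- The function field of the stage. -/
  K : Type u
  [instField : Field K]
  [instAlgebra : Algebra k K]
  /-- The `k`-valuation ring of the stage. -/
  O : ValuationSubring K
  /-- `k ⊆ O`. -/
  algebraMap_mem : ∀ c : k, algebraMap k K c ∈ O

-- the projections of the bundled structure, as for Mathlib's bundled objects (`ModuleCat`);
-- no library instance is overridden (the carrier `s.K` is a fresh type)
attribute [instance] VState.instField VState.instAlgebra

/-- "The stage **has a local uniformization**" (`Resolution.IsLocallyUniformizable`, equivalently a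
regular local model in the sense of §3 by `isLocallyUniformizable_iff_exists_isLocalUniformizationOf`).
[cite: CossartPiltant2008, Section 3 (HAL p. 4, "local uniformization")] -/
def VState.HasLU {k : Type u} [Field k] (s : VState k) : Prop :=
  IsLocallyUniformizable k s.K s.O

/-- `k ⊆ W ∩ K` when `k ⊆ W` (`W` a valuation ring of `L ⊇ K ⊇ k`). [folklore] -/
theorem forall_algebraMap_mem_comap {k K L : Type u} [Field k] [Field K] [Algebra k K] [Field L]
    [Algebra K L] [Algebra k L] [IsScalarTower k K L] {W : ValuationSubring L}
    (hkW : ∀ c : k, algebraMap k L c ∈ W) : ∀ c : k, algebraMap k K c ∈ W.comap (algebraMap K L) :=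
  fun c => by
    rw [ValuationSubring.mem_comap, ← IsScalarTower.algebraMap_apply k K L]
    exact hkW c

/-- `k ⊆ W ∩ K'` for an intermediate field `K ⊆ K' ⊆ L`, when `k ⊆ W`. [folklore] -/
theorem forall_algebraMap_mem_comap_intermediateField {k K L : Type u} [Field k] [Field K]
    [Algebra k K] [Field L] [Algebra K L] [Algebra k L] [IsScalarTower k K L]
    {W : ValuationSubring L} (hkW : ∀ c : k, algebraMap k L c ∈ W) (K' : IntermediateField K L) :
    ∀ c : k, algebraMap k K' c ∈ W.comap (algebraMap K' L) := fun c => by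
  rw [ValuationSubring.mem_comap, IsScalarTower.algebraMap_apply k K K',
    ← IsScalarTower.algebraMap_apply K K' L, ← IsScalarTower.algebraMap_apply k K L]
  exact hkW c

/-- `k ⊆ e⁻¹(O)` for a `k`-isomorphism `e : K₁ ≃ K₂` and `k ⊆ O ⊆ K₂`. [folklore] -/
theorem forall_algebraMap_mem_comap_algEquiv {k K₁ K₂ : Type u} [Field k] [Field K₁]
    [Algebra k K₁] [Field K₂] [Algebra k K₂] (e : K₁ ≃ₐ[k] K₂) {O : ValuationSubring K₂}
    (hk : ∀ c : k, algebraMap k K₂ c ∈ O) :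
    ∀ c : k, algebraMap k K₁ c ∈ O.comap (e : K₁ →+* K₂) := fun c => by
  rw [ValuationSubring.mem_comap, RingHom.coe_coe, AlgEquiv.commutes]
  exact hk c

/-- **An Artin–Schreier / `p`-th-root generator of `L/K` adapted to `R`** (HAL p. 20 l. 10–16 and
p. 21: "`K₁,ᵢ₊₁ = K₁,ᵢ(ηᵢ₊₁)` … it can be assumed that `η^p_{i+1} ∈ R₁,ᵢ` … with `R := R₁,ᵢ` and
`g := 0`, `f := −η^p_{i+1} ∈ m_R`"; the Galois degree-`p` steps "as in the purely inseparable
case"): there are `f, g ∈ R` of positive `O`-value, `g ≠ 0` if `k` is perfect, with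
`h := X^p − g^{p−1}X + f` irreducible over `K` and `L ≅ K[X]/(h)` — exactly the data the hypothesis
of Thm 7.2 (`ArtinSchreierHypothesis`) is applied to.
[cite: CossartPiltant2008, Thm 7.2 proof (HAL pp. 20–21, choice of `f`, `g`)] -/
def AdmitsASGenerator {k K : Type u} [Field k] [Field K] [Algebra k K] (p : ℕ)
    (O : ValuationSubring K) (R : Subalgebra k K) (L : Type u) [Field L] [Algebra K L] : Prop :=
  ∃ f g : K, f ∈ R ∧ g ∈ R ∧ O.valuation f < 1 ∧ O.valuation g < 1 ∧ (PerfectField k → g ≠ 0) ∧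
    Irreducible (X ^ p - C (g ^ (p - 1)) * X + C f : K[X]) ∧
    Nonempty (IsAdjoinRoot L (X ^ p - C (g ^ (p - 1)) * X + C f : K[X]))

/-- **One step of the proof of Thm 7.2** (HAL pp. 20–21), as a relation between stages; each
constructor carries exactly the non-inductive hypotheses of the result the proof invokes there:
* `inertiaUp` — "By corollary 6.3 applied to `L/K₀`, `W` and `K' := K₀ⁱ`" (Cor 6.3,
  `ClimbToInertiaField`): from `(K, W ∩ K)` to `(K', W ∩ K')`, `K' ⊆ Kⁱ`, `L/K` finite Galois;
* `primeUp` — "by proposition 8.3 (2)" / "proposition 8.3 (nonimmediate case)"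
  (`PrimeDegreeAscent`): from `(K, W ∩ K)` to `(L, W)`, `[L:K]` prime, `W` of rank one,
  `f = [L:K]` or `e = [L:K]`;
* `artinSchreier` — "by assumption in the statement of the theorem (immediate case)"
  (`ArtinSchreierHypothesis k`): from `(K, V)` (rank one, `κ(V)/k` algebraic) to `(L, W)`, `W` the
  unique extension of `V`, immediate, `L = K[X]/(X^p − g^{p−1}X + f)` with `f, g ∈ m_R` available
  for every local uniformization `R` of `V` (`AdmitsASGenerator`), `p = char k`;
* `ramificationDown` — "By proposition 9.5 below applied to `L/K`, `W` and `K' := Kʳ`"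
  (`DescentBelowRamificationField`): from `(K', W ∩ K')` to `(K, W ∩ K)`, `K' ⊆ Kʳ`, `W` of rank
  one with `κ(W)/k` algebraic;
* `iso` — renaming a stage along a `k`-isomorphism of valued fields `(K₁, e⁻¹ O) ≅ (K₂, O)`
  (implicit in print, where all fields sit inside one algebraic closure; it lets a formal tower
  re-present a field, e.g. `Kʳ` as an intermediate field of `L/K` rather than of `L/K₀ʳ`); sound
  by the tree's transport `Resolution.isLocallyUniformizable_comap_of_model`.
[cite: CossartPiltant2008, Thm 7.2 proof (HAL pp. 20–21)] -/
inductive Move3 (k : Type u) [Field k] : VState k → VState k → Prop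
  | inertiaUp {K : Type u} [Field K] [Algebra k K] (hfg : (⊤ : IntermediateField k K).FG)
      (h3 : Algebra.trdeg k K = 3) {L : Type u} [Field L] [Algebra K L] [Algebra k L]
      [IsScalarTower k K L] (hfin : FiniteDimensional K L) (hgal : IsGalois K L)
      (W : ValuationSubring L) (hkW : ∀ c : k, algebraMap k L c ∈ W) (K' : IntermediateField K L)
      (hK' : LeInertiaField K W K') :
      Move3 k ⟨K, W.comap (algebraMap K L), forall_algebraMap_mem_comap hkW⟩
        ⟨K', W.comap (algebraMap K' L), forall_algebraMap_mem_comap_intermediateField hkW K'⟩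
  | primeUp {K : Type u} [Field K] [Algebra k K] (hfg : (⊤ : IntermediateField k K).FG)
      (h3 : Algebra.trdeg k K = 3) {L : Type u} [Field L] [Algebra K L] [Algebra k L]
      [IsScalarTower k K L] (hprime : (Module.finrank K L).Prime) (W : ValuationSubring L)
      (hkW : ∀ c : k, algebraMap k L c ∈ W) (h1 : Nonempty W.valuation.RankOne)
      (hef : inertiaDegree K W = Module.finrank K L ∨ ramificationIndex K W = Module.finrank K L) :
      Move3 k ⟨K, W.comap (algebraMap K L), forall_algebraMap_mem_comap hkW⟩ ⟨L, W, hkW⟩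
  | artinSchreier {K : Type u} [Field K] [Algebra k K] (hfg : (⊤ : IntermediateField k K).FG)
      (h3 : Algebra.trdeg k K = 3) (O : ValuationSubring K) (hk : ∀ c : k, algebraMap k K c ∈ O)
      (h1 : Nonempty O.valuation.RankOne) (halg : residueTrdeg k O hk = 0) (p : ℕ) (hp : p.Prime)
      (hchar : CharP k p) {L : Type u} [Field L] [Algebra K L] [Algebra k L] [IsScalarTower k K L]
      (W : ValuationSubring L) (hkW : ∀ c : k, algebraMap k L c ∈ W)
      (hWO : W.comap (algebraMap K L) = O)
      (huniq : ∀ W' : ValuationSubring L, W'.comap (algebraMap K L) = O → W' = W)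
      (himm : IsImmediate K W)
      (hgen : ∀ R : Subalgebra k K, IsLocalUniformizationOf k K O R → AdmitsASGenerator p O R L) :
      Move3 k ⟨K, O, hk⟩ ⟨L, W, hkW⟩
  | ramificationDown {K : Type u} [Field K] [Algebra k K] (hfg : (⊤ : IntermediateField k K).FG)
      (h3 : Algebra.trdeg k K = 3) {L : Type u} [Field L] [Algebra K L] [Algebra k L]
      [IsScalarTower k K L] (hfin : FiniteDimensional K L) (hgal : IsGalois K L)
      (W : ValuationSubring L) (hkW : ∀ c : k, algebraMap k L c ∈ W)
      (h1 : Nonempty W.valuation.RankOne) (halg : residueTrdeg k W hkW = 0)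
      (K' : IntermediateField K L) (hK' : LeRamificationField K W K') :
      Move3 k ⟨K', W.comap (algebraMap K' L), forall_algebraMap_mem_comap_intermediateField hkW K'⟩
        ⟨K, W.comap (algebraMap K L), forall_algebraMap_mem_comap hkW⟩
  | iso {K₁ K₂ : Type u} [Field K₁] [Algebra k K₁] [Field K₂] [Algebra k K₂] (e : K₁ ≃ₐ[k] K₂)
      (O : ValuationSubring K₂) (hk : ∀ c : k, algebraMap k K₂ c ∈ O) :
      Move3 k ⟨K₁, O.comap (e : K₁ →+* K₂), forall_algebraMap_mem_comap_algEquiv e hk⟩ ⟨K₂, O, hk⟩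

/-- **Finitely many steps**: the reflexive–transitive closure of `Move3`. [folklore] -/
def Reach3 (k : Type u) [Field k] : VState k → VState k → Prop :=
  Relation.ReflTransGen (Move3 k)

/-- **Local uniformization propagates along one move** — PROVED from Cor 6.3, Prop 8.3, Prop 9.5
and the hypothesis of Thm 7.2 (for the Artin–Schreier move: the local uniformization of the
lower stage gives a regular local model `R` by
`LocalModels2008.exists_isLocalUniformizationOf`, the adapted generator is supplied by
`AdmitsASGenerator`, and `ArtinSchreierHypothesis k` fires). [folklore] -/
theorem Move3.hasLU {k : Type u} [Field k] (h63 : ClimbToInertiaField.{u})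
    (h83 : PrimeDegreeAscent.{u}) (h95 : DescentBelowRamificationField.{u})
    (hAS : ArtinSchreierHypothesis k) {s t : VState k} (h : Move3 k s t) (hs : s.HasLU) :
    t.HasLU := by
  cases h with
  | inertiaUp hfg h3 hfin hgal W hkW K' hK' =>
    exact h63 k _ hfg h3 _ hfin hgal W hkW K' hK' hs
  | primeUp hfg h3 hprime W hkW h1 hef =>
    exact h83 k _ hfg h3 _ hprime W hkW h1 hef hs
  | artinSchreier hfg h3 O hk h1 halg p hp hchar W hkW hWO huniq himm hgen =>
    obtain ⟨R, hR⟩ := exists_isLocalUniformizationOf O hs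
    obtain ⟨f, g, hf, hg, hvf, hvg, hg0, hirr, hL⟩ := hgen R hR
    exact hAS p hp hchar _ hfg h3 O hk h1 halg R hR f g hf hg hvf hvg hg0 hirr _ hL W hWO huniq himm
  | ramificationDown hfg h3 hfin hgal W hkW h1 halg K' hK' =>
    exact h95 k _ hfg h3 _ hfin hgal W hkW h1 halg K' hK' hs
  | @iso K₁ K₂ _ _ _ _ e O hk =>
    obtain ⟨A, hA, hfg, hfrac, hreg⟩ := hs
    have key := isLocallyUniformizable_comap_of_model (e.symm : K₂ →ₐ[k] K₁)
      (O.comap (e : K₁ →+* K₂)) A hA (fun x _ => ⟨e x, e.symm_apply_apply x⟩) hfg (fun z => by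
        obtain ⟨a, b, hb, hab⟩ := IsFractionRing.div_surjective (A := A) (e.symm z)
        refine ⟨a, b, a.2, b.2, ?_, hab.symm⟩
        have hb0 : b ≠ 0 := nonZeroDivisors.ne_zero hb
        exact fun h => hb0 (Subtype.ext h)) hreg
    have hO : (O.comap (e : K₁ →+* K₂)).comap ((e.symm : K₂ →ₐ[k] K₁) : K₂ →+* K₁) = O := by
      ext z
      simp [ValuationSubring.mem_comap]
    simpa only [VState.HasLU, hO] using key

/-- **Local uniformization propagates along finitely many moves.** [folklore] -/
theorem Reach3.hasLU {k : Type u} [Field k] (h63 : ClimbToInertiaField.{u})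
    (h83 : PrimeDegreeAscent.{u}) (h95 : DescentBelowRamificationField.{u})
    (hAS : ArtinSchreierHypothesis k) {s t : VState k} (h : Reach3 k s t) (hs : s.HasLU) :
    t.HasLU := by
  induction h with
  | refl => exact hs
  | tail _ hm ih => exact hm.hasLU h63 h83 h95 hAS ih

/-! ### The tower (HAL pp. 20–21) and Theorem 7.2 -/

/-- **The tower of the proof of Thm 7.2 exists** (Cossart–Piltant 2008, HAL pp. 20–21) — NAMED
FACT, the field/valuation-theoretic skeleton of the proof with the local-uniformization content
removed: for `k` of characteristic `p > 0`, `K/k` finitely generated of transcendence degree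
three and `V` a `k`-valuation ring of `K` of rank one with `κ(V)/k` algebraic, there is a purely
transcendental stage `(K₀, V₀)`, `K₀ = k(x₁, x₂, x₃)` (the paper's `V₀ := V ∩ k(x₁,x₂,x₃)` for a
transcendence basis), from which `(K, V)` is reached by finitely many moves (`Move3`): the climb
`K₀ ⊆ K₀ⁱ` (Cor 6.3), the towers `K₀ⁱ ⊆ K₀ʳ` (abelian of prime degrees `lᵢ ≠ p`, totally ramified
by eqs. (8)–(9): Prop 8.3 (2)) and `K₀ʳ ⊆ Kʳ` (Galois of degree `p` from a central series of the
`p`-group `G⁰_r`, eq. (32); each step immediate — hypothesis of Thm 7.2 with the rescaled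
Artin–Schreier generator — or with `e = p` or `f = p` — Prop 8.3), the descent `Kʳ ⊇ K₁`
(Prop 9.5, `K₁` the separable closure of `K₀` in `K`), and the purely inseparable degree-`p` tower
`K₁ ⊂ K₁,₁ ⊂ … ⊂ K` (Prop 8.3 or the hypothesis with `g = 0`; empty when `k` is perfect, by a
separating transcendence basis, Matsumura Thm 26.3), all stages being finitely generated of
transcendence degree three with rank-one valuation rings and algebraic residue extensions.
[cite: CossartPiltant2008, Thm 7.2 proof (HAL pp. 20–21)] -/
def TowerExists2008 (k : Type u) [Field k] : Prop :=
  ∀ (p : ℕ), p.Prime → CharP k p →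
  ∀ (K : Type u) [Field K] [Algebra k K], (⊤ : IntermediateField k K).FG → Algebra.trdeg k K = 3 →
  ∀ (O : ValuationSubring K) (hk : ∀ c : k, algebraMap k K c ∈ O), Nonempty O.valuation.RankOne →
    residueTrdeg k O hk = 0 →
    ∃ s₀ : VState k, (∃ x : Fin 3 → s₀.K, AlgebraicIndependent k x ∧
      IntermediateField.adjoin k (Set.range x) = ⊤) ∧ Reach3 k s₀ ⟨K, O, hk⟩

/-- **Theorem 7.2 for `k`, from its leaves** — PROVED: Cor 6.3, Prop 8.3, Prop 9.5, the tower, and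
the hypothesis of Thm 7.2 give local uniformization of every rank-one `k`-valuation ring with
algebraic residue extension in transcendence degree three (the base stage is uniformized by
`isLocallyUniformizable_of_algebraicIndependent_of_adjoin_eq_top`, then `Reach3.hasLU`).
[cite: CossartPiltant2008, Thm 7.2 (HAL pp. 19–21)] -/
theorem lu3RankOne_of_tower {k : Type u} [Field k] {p : ℕ} (hp : p.Prime) (hchar : CharP k p)
    (h63 : ClimbToInertiaField.{u}) (h83 : PrimeDegreeAscent.{u})
    (h95 : DescentBelowRamificationField.{u}) (hT : TowerExists2008 k)
    (hAS : ArtinSchreierHypothesis k) : LU3RankOne k := by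
  intro K _ _ hfg h3 O hk h1 halg
  obtain ⟨s₀, ⟨x, hx, htop⟩, hreach⟩ := hT p hp hchar K hfg h3 O hk h1 halg
  have h0 : s₀.HasLU :=
    isLocallyUniformizable_of_algebraicIndependent_of_adjoin_eq_top x hx htop s₀.O s₀.algebraMap_mem
  exact hreach.hasLU h63 h83 h95 hAS h0

/-- **Cossart–Piltant 2008, Theorem 7.2 (`ReductionToArtinSchreier`) from its leaves** — PROVED:
the named fact of `Ramification2008.lean` follows from Cor 6.3 (`ClimbToInertiaField`), Prop 8.3
(`PrimeDegreeAscent`), Prop 9.5 (`DescentBelowRamificationField`) and the tower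
(`TowerExists2008`). [cite: CossartPiltant2008, Thm 7.2 (HAL pp. 19–21)] -/
theorem reductionToArtinSchreier_of_tower (h63 : ClimbToInertiaField.{u})
    (h83 : PrimeDegreeAscent.{u}) (h95 : DescentBelowRamificationField.{u})
    (hT : ∀ (k : Type u) [Field k], TowerExists2008 k) : ReductionToArtinSchreier.{u} :=
  fun k _ p _ _ hAS => lu3RankOne_of_tower (k := k) (Fact.out : p.Prime) ‹CharP k p› h63 h83 h95
    (hT k) hAS

/-- **The local uniformization theorem of Cossart–Piltant 2008 from its leaves, with Thm 7.2
unfolded** — PROVED: Prop 5.1 (`RankReduction`), Cor 6.3, Prop 8.3, Prop 9.5, the tower and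
[CP2]'s Main theorem (`CossartPiltant2009Main`) give `LU3DiffFinite`
(via `Threefolds2008.lu3_of_leaves`). [cite: CossartPiltant2008, Thm 2.1 proof (HAL pp. 3–4, 16, 19–21)] -/
theorem lu3DiffFinite_of_tower (p51 : RankReduction.{u}) (h63 : ClimbToInertiaField.{u})
    (h83 : PrimeDegreeAscent.{u}) (h95 : DescentBelowRamificationField.{u})
    (hT : ∀ (k : Type u) [Field k], TowerExists2008 k) (cp2 : CossartPiltant2009Main.{u}) :
    LU3DiffFinite.{u} :=
  lu3_of_leaves p51 (reductionToArtinSchreier_of_tower h63 h83 h95 hT) cp2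

end Literature.AlgebraicGeometry.CossartPiltant200819.CP2008
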